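/-
Copyright: the b2b-balaban T⁴-continuum CRUX team, row NE7b OWNER lineage `t4-ne7b-p1` (gen 140). Project licence.
-/
import Mathlib.MeasureTheory.Function.L2Space
import Mathlib.Probability.Moments.Variance
import Mathlib.Analysis.SpecialFunctions.Sqrt

/-!
# THE TRUNCATION BOUND FOR A THIRD CENTRED MOMENT (SCOPING (d11)(4) — third-order kernel letters, first file): Dobrushin's estimate
# (442)∕(447)∕(457) bounds covariances of GLOBALLY Lipschitz observables; the third cumulant `E[F̃G̃H̃] = Cov(F, G̃H̃)` (`X̃ = X − E X`) pairs
# `F` with a PRODUCT of two Lipschitz functions, which is not Lipschitz.  TRUNCATION repairs this: with the clamp `T_R u = max(−R, min(R, u))`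
# (`|T_Ru| ≤ R`, `1`-Lipschitz — the tree's `Literature.Analysis.FunctionSpaces` clamp lemmas —, `|u − T_Ru| ≤ u²∕R`, `|T_Ru| ≤ |u|`) the product `T_RG̃·T_RH̃` IS Lipschitz (vector `R(b + h)` if `G, H` have
# vectors `b, h`), and the defect is a tail controlled by FOURTH CENTRED MOMENTS ((423) in whitened coordinates):
#   `|E[F̃G̃H̃] − E[F̃·T_RG̃·T_RH̃]| ≤ (½E F̃⁴ + ¾E G̃⁴ + ¾E H̃⁴)∕R ≤ 2m₄∕R`,
# so that, whenever `|E[F̃·T_RG̃·T_RH̃]| ≤ R·ε` for all `R > 0` (Dobrushin: `ε = B(a,b) + B(a,h)`), OPTIMISING `R` gives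
#   `|E[F̃G̃H̃]| ≤ 2√(2·ε·m₄)` — tree decay at HALF the two-point rate, volume-uniform (row NE7b, node U5c; Mathlib only; [folklore])

Cell `pub-balaban`, sub-cell `t4`, spine estimate NE7b (`T4WeightBudget.RelWeightBound`; the cell's OWN estimate — NOT PRINTED in
[Bałaban 1983–89], NOT PROVED).  Crux-route work under `Spine/NE7b/` by the row OWNER (`t4-ne7b-p1` gen 140, file (460)) under FREEZE
(0)'s crux-prover clause; NOTHING of Bałaban's is named as a Lean object, valued or asserted; no `T4Continuum/Support` leaf typed; no
`def`, no notation (the clamp is WRITTEN OUT as `max (-R) (min R u)`); zero `sorry`.  Imports: Mathlib only.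

WHAT IS PROVED ([folklore]; `μ` a probability measure, `F, G, H` measurable with integrable fourth centred powers, centring constants
`mF, mG, mH` ARBITRARY):
* §1 the clamp's product defect `prod_sub_clamp_prod_abs_le` (`|uv − T_Ru·T_Rv| ≤ (u²|v| + |u|v²)∕R`; `|T_Ru| ≤ |u|`, `|u − T_Ru| ≤ u²∕R` inline;
  `|T_Ru| ≤ R` and `1`-Lipschitz are the tree's `Literature.Analysis.FunctionSpaces.abs_max_neg_min_le` ∕ `abs_clamp_sub_clamp_le`).
* §2 pointwise quartic dominations: `abs_mul_sq_mul_abs_le` (`|f|g²|h| ≤ (f⁴+h⁴)∕4 + g⁴∕2`), `abs_triple_le`, `abs_le_quartic`.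
* §3 integrability from fourth moments: `integrable_of_quartic_domination`, `integrable_triple`, `integrable_clamped`.
* §4 THE SPLIT **`third_centred_split_le`** and the uniform form **`third_centred_split_le'`** (`≤ 2m₄∕R`).
* §5 THE OPTIMISATION `le_two_sqrt_of_forall` and THE END **`third_centred_le_of_truncated`** (`|E[F̃G̃H̃]| ≤ 2√(2εm₄)`).
* §6 toy: `R = 1`, `u = 2`: `T_1 2 = 1`.

HONEST (what this is NOT).  Pure measure theory; the Lipschitz vector `R(b + h)` of the clamped product, the Dobrushin bound `ε` with DECAY
(weighted Neumann (453)) and the fourth-moment letter `m₄` ((423) whitened) are the successor files'; orders four and five (the marginal and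
first irrelevant kernel letters of (431)) follow the same pattern with products of more clamped factors — NOT typed here.  Scalar skeleton
((A3), NC-NE7b-α UNRULED); nothing of Bałaban's asserted.  BY-NAME EFFECT ON THE WALL: NONE.  NE7b NOT PRINTED ∕ NOT PROVED; spine PROVED
0∕9; rung (B)+1 — the programme's measures remain FINITE-torus statements; NOT the mass gap, NOT Clay.  HONEST DEPENDENCY: continuum YM on
T⁴ ⇐ BetaPertH ∧ nine spine estimates (0∕9 proved); BetaPertH ⇐ (D1) ∧ (D4) ∧ CAP+tail; G-an2-4 gates asym, D1 and NE2∕3∕4.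
-/

set_option autoImplicit false

noncomputable section

namespace Summit.QuantumFields.BalabanUV.T4Continuum.NE7b.SupTruncationCumulantBound

open MeasureTheory Real
open scoped BigOperators

/-! ## §1. The clamp `T_R u = max (-R) (min R u)` -/

/-- **The product defect of the clamp**: `|uv − T_Ru·T_Rv| ≤ (u²|v| + |u|v²)∕R` for `R > 0`, from the three elementary clamp facts
`|T_Ru| ≤ |u|`, `|u − T_Ru| ≤ u²∕R` (zero on `|u| ≤ R`, at most `|u|` beyond) — proved inline; the bound `|T_Ru| ≤ R` and the
`1`-Lipschitz property are the tree's `Literature.Analysis.FunctionSpaces.abs_max_neg_min_le` ∕ `abs_clamp_sub_clamp_le` (not restated).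
[folklore] -/
theorem prod_sub_clamp_prod_abs_le {R : ℝ} (hR : 0 < R) (u v : ℝ) :
    |u * v - max (-R) (min R u) * max (-R) (min R v)| ≤ (u ^ 2 * |v| + |u| * v ^ 2) / R := by
  -- `|T_Rw| ≤ |w|`
  have hshrink : ∀ w : ℝ, |max (-R) (min R w)| ≤ |w| := fun w => by
    rcases le_or_gt w (-R) with h1 | h1
    · rw [min_eq_right (by linarith), max_eq_left h1, abs_of_nonpos (by linarith), abs_of_nonpos (by linarith)]; linarith
    · rcases le_or_gt w R with h2 | h2
      · rw [min_eq_right h2, max_eq_right h1.le]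
      · rw [min_eq_left h2.le, max_eq_right (by linarith), abs_of_nonneg hR.le, abs_of_pos (by linarith)]; linarith
  -- `|w − T_Rw|·R ≤ w²`
  have hdef : ∀ w : ℝ, |w - max (-R) (min R w)| * R ≤ w ^ 2 := fun w => by
    rcases le_or_gt w (-R) with h1 | h1
    · rw [min_eq_right (by linarith), max_eq_left h1, abs_of_nonpos (by linarith)]; nlinarith
    · rcases le_or_gt w R with h2 | h2
      · rw [min_eq_right h2, max_eq_right h1.le, sub_self, abs_zero, zero_mul]; positivity
      · rw [min_eq_left h2.le, max_eq_right (by linarith), abs_of_nonneg (by linarith)]; nlinarith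
  have e : u * v - max (-R) (min R u) * max (-R) (min R v) =
      (u - max (-R) (min R u)) * v + max (-R) (min R u) * (v - max (-R) (min R v)) := by ring
  rw [e, le_div_iff₀ hR]
  refine le_trans (mul_le_mul_of_nonneg_right (abs_add_le _ _) hR.le) ?_
  rw [abs_mul, abs_mul, add_mul]
  have h1 : |u - max (-R) (min R u)| * |v| * R ≤ u ^ 2 * |v| := by nlinarith [hdef u, abs_nonneg v]
  have h2 : |max (-R) (min R u)| * |v - max (-R) (min R v)| * R ≤ |u| * v ^ 2 := by
    nlinarith [hdef v, hshrink u, abs_nonneg u, abs_nonneg (max (-R) (min R u)), abs_nonneg (v - max (-R) (min R v))]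
  linarith

/-! ## §2. Pointwise quartic dominations -/

/-- `|f|·g²·|h| ≤ (f⁴ + h⁴)∕4 + g⁴∕2` (two arithmetic–geometric means). [folklore] -/
theorem abs_mul_sq_mul_abs_le (f g h : ℝ) : |f| * g ^ 2 * |h| ≤ (f ^ 4 + h ^ 4) / 4 + g ^ 4 / 2 := by
  have h1 : |f| * |h| ≤ (f ^ 2 + h ^ 2) / 2 := by nlinarith [sq_nonneg (|f| - |h|), sq_abs f, sq_abs h]
  have h2 : g ^ 2 * f ^ 2 ≤ (g ^ 4 + f ^ 4) / 2 := by nlinarith [sq_nonneg (g ^ 2 - f ^ 2)]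
  have h3 : g ^ 2 * h ^ 2 ≤ (g ^ 4 + h ^ 4) / 2 := by nlinarith [sq_nonneg (g ^ 2 - h ^ 2)]
  have h4 : |f| * g ^ 2 * |h| = g ^ 2 * (|f| * |h|) := by ring
  rw [h4]
  nlinarith [sq_nonneg g, h1, h2, h3]

/-- `|fgh| ≤ (f⁴ + 1)∕4 + (g⁴ + h⁴)∕4`. [folklore] -/
theorem abs_triple_le (f g h : ℝ) : |f * g * h| ≤ (f ^ 4 + 1) / 4 + (g ^ 4 + h ^ 4) / 4 := by
  rw [abs_mul, abs_mul]
  have h1 : |g| * |h| ≤ (g ^ 2 + h ^ 2) / 2 := by nlinarith [sq_nonneg (|g| - |h|), sq_abs g, sq_abs h]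
  have h2 : |f| * ((g ^ 2 + h ^ 2) / 2) ≤ (f ^ 2 + ((g ^ 2 + h ^ 2) / 2) ^ 2) / 2 := by
    nlinarith [sq_nonneg (|f| - (g ^ 2 + h ^ 2) / 2), sq_abs f]
  have h3 : ((g ^ 2 + h ^ 2) / 2) ^ 2 ≤ (g ^ 4 + h ^ 4) / 2 := by nlinarith [sq_nonneg (g ^ 2 - h ^ 2)]
  have h4 : f ^ 2 ≤ (f ^ 4 + 1) / 2 := by nlinarith [sq_nonneg (f ^ 2 - 1)]
  calc |f| * |g| * |h| = |f| * (|g| * |h|) := by ring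
    _ ≤ |f| * ((g ^ 2 + h ^ 2) / 2) := mul_le_mul_of_nonneg_left h1 (abs_nonneg f)
    _ ≤ (f ^ 4 + 1) / 4 + (g ^ 4 + h ^ 4) / 4 := by linarith

/-- `|f| ≤ (f⁴ + 3)∕4`. [folklore] -/
theorem abs_le_quartic (f : ℝ) : |f| ≤ (f ^ 4 + 3) / 4 := by
  have h1 : |f| ≤ (f ^ 2 + 1) / 2 := by nlinarith [sq_nonneg (|f| - 1), sq_abs f]
  have h2 : f ^ 2 ≤ (f ^ 4 + 1) / 2 := by nlinarith [sq_nonneg (f ^ 2 - 1)]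
  linarith

/-! ## §3. Integrability from fourth centred moments -/

variable {Ω : Type*} [MeasurableSpace Ω] {μ : Measure Ω} {F G H : Ω → ℝ} {mF mG mH : ℝ}

/-- A measurable function dominated by `c₀ + c₁f̃⁴ + c₂g̃⁴ + c₃h̃⁴` is integrable (probability measure). [folklore] -/
theorem integrable_of_quartic_domination [IsProbabilityMeasure μ] (hF4 : Integrable (fun ω => (F ω - mF) ^ 4) μ)
    (hG4 : Integrable (fun ω => (G ω - mG) ^ 4) μ) (hH4 : Integrable (fun ω => (H ω - mH) ^ 4) μ) {X : Ω → ℝ} (hX : Measurable X)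
    (c₀ c₁ c₂ c₃ : ℝ) (hdom : ∀ ω, |X ω| ≤ c₀ + c₁ * (F ω - mF) ^ 4 + c₂ * (G ω - mG) ^ 4 + c₃ * (H ω - mH) ^ 4) : Integrable X μ := by
  have hb : Integrable (fun ω => c₀ + c₁ * (F ω - mF) ^ 4 + c₂ * (G ω - mG) ^ 4 + c₃ * (H ω - mH) ^ 4) μ :=
    (((integrable_const c₀).add (hF4.const_mul c₁)).add (hG4.const_mul c₂)).add (hH4.const_mul c₃)
  exact hb.mono' hX.aestronglyMeasurable (ae_of_all _ fun ω => by rw [Real.norm_eq_abs]; exact hdom ω)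

/-- **The triple product `F̃G̃H̃` is integrable**. [folklore] -/
theorem integrable_triple [IsProbabilityMeasure μ] (hF : Measurable F) (hG : Measurable G) (hH : Measurable H)
    (hF4 : Integrable (fun ω => (F ω - mF) ^ 4) μ) (hG4 : Integrable (fun ω => (G ω - mG) ^ 4) μ) (hH4 : Integrable (fun ω => (H ω - mH) ^ 4) μ) :
    Integrable (fun ω => (F ω - mF) * (G ω - mG) * (H ω - mH)) μ :=
  integrable_of_quartic_domination hF4 hG4 hH4 (((hF.sub_const mF).mul (hG.sub_const mG)).mul (hH.sub_const mH)) (1 / 4) (1 / 4) (1 / 4) (1 / 4)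
    fun ω => by have h := abs_triple_le (F ω - mF) (G ω - mG) (H ω - mH); linarith

/-- **The clamped product `F̃·T_RG̃·T_RH̃` is integrable** (`R ≥ 0`). [folklore] -/
theorem integrable_clamped [IsProbabilityMeasure μ] (hF : Measurable F) (hG : Measurable G) (hH : Measurable H) {R : ℝ} (hR : 0 ≤ R)
    (hF4 : Integrable (fun ω => (F ω - mF) ^ 4) μ) (hG4 : Integrable (fun ω => (G ω - mG) ^ 4) μ) (hH4 : Integrable (fun ω => (H ω - mH) ^ 4) μ) :
    Integrable (fun ω => (F ω - mF) * (max (-R) (min R (G ω - mG)) * max (-R) (min R (H ω - mH)))) μ := by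
  refine integrable_of_quartic_domination hF4 hG4 hH4 ((hF.sub_const mF).mul ((measurable_const.max (measurable_const.min (hG.sub_const mG))).mul
    (measurable_const.max (measurable_const.min (hH.sub_const mH))))) (R ^ 2 * (3 / 4)) (R ^ 2 * (1 / 4)) 0 0 fun ω => ?_
  rw [abs_mul, abs_mul]
  have h1 : |max (-R) (min R (G ω - mG))| ≤ R := abs_le.2 ⟨le_max_left _ _, max_le (by linarith) (min_le_left _ _)⟩
  have h2 : |max (-R) (min R (H ω - mH))| ≤ R := abs_le.2 ⟨le_max_left _ _, max_le (by linarith) (min_le_left _ _)⟩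
  have h3 := abs_le_quartic (F ω - mF)
  have h4 : |max (-R) (min R (G ω - mG))| * |max (-R) (min R (H ω - mH))| ≤ R * R := mul_le_mul h1 h2 (abs_nonneg _) hR
  calc |F ω - mF| * (|max (-R) (min R (G ω - mG))| * |max (-R) (min R (H ω - mH))|) ≤ (F ω - mF) ^ 4 / 4 * (R * R) + 3 / 4 * (R * R) := by
        nlinarith [abs_nonneg (F ω - mF), mul_nonneg (abs_nonneg (max (-R) (min R (G ω - mG)))) (abs_nonneg (max (-R) (min R (H ω - mH))))]
    _ = R ^ 2 * (3 / 4) + R ^ 2 * (1 / 4) * (F ω - mF) ^ 4 + 0 * (G ω - mG) ^ 4 + 0 * (H ω - mH) ^ 4 := by ring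

/-! ## §4. The split -/

/-- **THE TRUNCATION SPLIT**: for `R > 0` and arbitrary centring constants,
`|∫F̃G̃H̃ − ∫F̃·T_RG̃·T_RH̃| ≤ (½∫F̃⁴ + ¾∫G̃⁴ + ¾∫H̃⁴)∕R`. [folklore] -/
theorem third_centred_split_le [IsProbabilityMeasure μ] (hF : Measurable F) (hG : Measurable G) (hH : Measurable H) {R : ℝ} (hR : 0 < R)
    (hF4 : Integrable (fun ω => (F ω - mF) ^ 4) μ) (hG4 : Integrable (fun ω => (G ω - mG) ^ 4) μ) (hH4 : Integrable (fun ω => (H ω - mH) ^ 4) μ) :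
    |(∫ ω, (F ω - mF) * (G ω - mG) * (H ω - mH) ∂μ) - ∫ ω, (F ω - mF) * (max (-R) (min R (G ω - mG)) * max (-R) (min R (H ω - mH))) ∂μ| ≤
      ((∫ ω, (F ω - mF) ^ 4 ∂μ) / 2 + 3 * (∫ ω, (G ω - mG) ^ 4 ∂μ) / 4 + 3 * (∫ ω, (H ω - mH) ^ 4 ∂μ) / 4) / R := by
  have hI3 := integrable_triple hF hG hH hF4 hG4 hH4
  have hIK := integrable_clamped hF hG hH hR.le hF4 hG4 hH4
  rw [← integral_sub hI3 hIK]
  -- pointwise domination of the defect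
  have hdom : ∀ ω, |(F ω - mF) * (G ω - mG) * (H ω - mH) - (F ω - mF) * (max (-R) (min R (G ω - mG)) * max (-R) (min R (H ω - mH)))| ≤
      ((F ω - mF) ^ 4 / 2 + 3 * (G ω - mG) ^ 4 / 4 + 3 * (H ω - mH) ^ 4 / 4) / R := fun ω => by
    set f := F ω - mF
    set g := G ω - mG
    set h := H ω - mH
    have e : f * g * h - f * (max (-R) (min R g) * max (-R) (min R h)) = f * (g * h - max (-R) (min R g) * max (-R) (min R h)) := by ring
    rw [e, abs_mul]
    have h1 := prod_sub_clamp_prod_abs_le hR g h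
    have h2 := abs_mul_sq_mul_abs_le f g h
    have h3 := abs_mul_sq_mul_abs_le f h g
    calc |f| * |g * h - max (-R) (min R g) * max (-R) (min R h)| ≤ |f| * ((g ^ 2 * |h| + |g| * h ^ 2) / R) :=
          mul_le_mul_of_nonneg_left h1 (abs_nonneg f)
      _ = (|f| * g ^ 2 * |h| + |f| * h ^ 2 * |g|) / R := by ring
      _ ≤ (((f ^ 4 + h ^ 4) / 4 + g ^ 4 / 2) + ((f ^ 4 + g ^ 4) / 4 + h ^ 4 / 2)) / R := by
          exact div_le_div_of_nonneg_right (add_le_add h2 h3) hR.le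
      _ = (f ^ 4 / 2 + 3 * g ^ 4 / 4 + 3 * h ^ 4 / 4) / R := by ring
  have hA : Integrable (fun ω => (F ω - mF) ^ 4 / 2) μ := hF4.div_const 2
  have hB : Integrable (fun ω => 3 * (G ω - mG) ^ 4 / 4) μ := (hG4.const_mul 3).div_const 4
  have hC : Integrable (fun ω => 3 * (H ω - mH) ^ 4 / 4) μ := (hH4.const_mul 3).div_const 4
  have hAB : Integrable (fun ω => (F ω - mF) ^ 4 / 2 + 3 * (G ω - mG) ^ 4 / 4) μ := hA.add hB
  have hABC : Integrable (fun ω => (F ω - mF) ^ 4 / 2 + 3 * (G ω - mG) ^ 4 / 4 + 3 * (H ω - mH) ^ 4 / 4) μ := hAB.add hC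
  have hbound : Integrable (fun ω => ((F ω - mF) ^ 4 / 2 + 3 * (G ω - mG) ^ 4 / 4 + 3 * (H ω - mH) ^ 4 / 4) / R) μ := hABC.div_const R
  refine (abs_integral_le_integral_abs).trans ((integral_mono_of_nonneg (ae_of_all _ fun ω => abs_nonneg _) hbound
    (ae_of_all _ hdom)).trans (le_of_eq ?_))
  have e1 : ∫ ω, (F ω - mF) ^ 4 / 2 + 3 * (G ω - mG) ^ 4 / 4 + 3 * (H ω - mH) ^ 4 / 4 ∂μ =
      (∫ ω, (F ω - mF) ^ 4 ∂μ) / 2 + 3 * (∫ ω, (G ω - mG) ^ 4 ∂μ) / 4 + 3 * (∫ ω, (H ω - mH) ^ 4 ∂μ) / 4 := by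
    rw [integral_add hAB hC, integral_add hA hB, integral_div, integral_div, integral_div, integral_const_mul, integral_const_mul]
  rw [integral_div, e1]

/-- **The uniform form**: with all three fourth centred moments `≤ m₄`, the defect is `≤ 2m₄∕R`. [folklore] -/
theorem third_centred_split_le' [IsProbabilityMeasure μ] (hF : Measurable F) (hG : Measurable G) (hH : Measurable H) {R m₄ : ℝ} (hR : 0 < R)
    (hF4 : Integrable (fun ω => (F ω - mF) ^ 4) μ) (hG4 : Integrable (fun ω => (G ω - mG) ^ 4) μ) (hH4 : Integrable (fun ω => (H ω - mH) ^ 4) μ)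
    (hmF : ∫ ω, (F ω - mF) ^ 4 ∂μ ≤ m₄) (hmG : ∫ ω, (G ω - mG) ^ 4 ∂μ ≤ m₄) (hmH : ∫ ω, (H ω - mH) ^ 4 ∂μ ≤ m₄) :
    |(∫ ω, (F ω - mF) * (G ω - mG) * (H ω - mH) ∂μ) - ∫ ω, (F ω - mF) * (max (-R) (min R (G ω - mG)) * max (-R) (min R (H ω - mH))) ∂μ| ≤
      2 * m₄ / R := by
  refine (third_centred_split_le hF hG hH hR hF4 hG4 hH4).trans (div_le_div_of_nonneg_right ?_ hR.le)
  linarith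

/-! ## §5. The optimisation in `R` -/

/-- **`x ≤ Rε + c∕R` for all `R > 0` (`ε, c ≥ 0`) ⟹ `x ≤ 2√(εc)`** (at `R = √(c∕ε)`; the degenerate cases by limits). [folklore] -/
theorem le_two_sqrt_of_forall {x ε c : ℝ} (hε : 0 ≤ ε) (hc : 0 ≤ c) (h : ∀ R : ℝ, 0 < R → x ≤ R * ε + c / R) : x ≤ 2 * Real.sqrt (ε * c) := by
  rcases hε.eq_or_lt with hε0 | hεpos
  · -- `ε = 0`: `x ≤ c/R` for all `R`, so `x ≤ 0`
    rw [← hε0, zero_mul, Real.sqrt_zero, mul_zero]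
    by_contra hx'
    have hx : 0 < x := lt_of_not_ge hx'
    have hR : 0 < c / x + 1 := by positivity
    have h1 := h (c / x + 1) hR
    rw [← hε0, mul_zero, zero_add] at h1
    have e : x * (c / x + 1) = c + x := by field_simp
    have h2 : c / (c / x + 1) < x := by
      rw [div_lt_iff₀ hR, e]
      linarith
    linarith
  rcases hc.eq_or_lt with hc0 | hcpos
  · -- `c = 0`: `x ≤ Rε` for all `R`, so `x ≤ 0`
    rw [← hc0, mul_zero, Real.sqrt_zero, mul_zero]
    by_contra hx'
    have hx : 0 < x := lt_of_not_ge hx'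
    have hR : 0 < x / (2 * ε) := by positivity
    have h1 := h (x / (2 * ε)) hR
    rw [← hc0, zero_div, add_zero] at h1
    have e : x / (2 * ε) * ε = x / 2 := by field_simp
    linarith
  · -- the generic case: `R = √(c/ε)`
    set R : ℝ := Real.sqrt (c / ε) with hRdef
    have hR : 0 < R := Real.sqrt_pos.2 (div_pos hcpos hεpos)
    have h1 := h R hR
    have hR2 : R ^ 2 = c / ε := Real.sq_sqrt (div_nonneg hc hε)
    have hc' : c = R ^ 2 * ε := by rw [hR2]; field_simp
    have hcR : c / R = R * ε := by
      rw [div_eq_iff hR.ne', hc']; ring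
    have e2 : ε * c = (R * ε) ^ 2 := by rw [hc']; ring
    have hs : Real.sqrt (ε * c) = R * ε := by rw [e2, Real.sqrt_sq (by positivity)]
    rw [hcR] at h1
    rw [hs]
    linarith

/-- **THE THIRD CENTRED MOMENT UNDER A TRUNCATED-COVARIANCE BOUND**: if the clamped pairings satisfy `|∫F̃·T_RG̃·T_RH̃| ≤ R·ε` for every
`R > 0` (`ε ≥ 0` — in the application Dobrushin's bound for the Lipschitz product) and the fourth centred moments are `≤ m₄`, then
`|∫F̃G̃H̃| ≤ 2√(2·ε·m₄)`. [folklore] -/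
theorem third_centred_le_of_truncated [IsProbabilityMeasure μ] (hF : Measurable F) (hG : Measurable G) (hH : Measurable H) {ε m₄ : ℝ}
    (hε : 0 ≤ ε) (hF4 : Integrable (fun ω => (F ω - mF) ^ 4) μ) (hG4 : Integrable (fun ω => (G ω - mG) ^ 4) μ)
    (hH4 : Integrable (fun ω => (H ω - mH) ^ 4) μ) (hmF : ∫ ω, (F ω - mF) ^ 4 ∂μ ≤ m₄) (hmG : ∫ ω, (G ω - mG) ^ 4 ∂μ ≤ m₄)
    (hmH : ∫ ω, (H ω - mH) ^ 4 ∂μ ≤ m₄)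
    (htr : ∀ R : ℝ, 0 < R → |∫ ω, (F ω - mF) * (max (-R) (min R (G ω - mG)) * max (-R) (min R (H ω - mH))) ∂μ| ≤ R * ε) :
    |∫ ω, (F ω - mF) * (G ω - mG) * (H ω - mH) ∂μ| ≤ 2 * Real.sqrt (2 * ε * m₄) := by
  have hm : 0 ≤ m₄ := le_trans (integral_nonneg fun ω => by positivity) hmF
  have e : 2 * ε * m₄ = ε * (2 * m₄) := by ring
  rw [e]
  refine le_two_sqrt_of_forall hε (by positivity) fun R hR => ?_
  have h1 := third_centred_split_le' hF hG hH hR hF4 hG4 hH4 hmF hmG hmH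
  have h2 := htr R hR
  have h3 := abs_sub_abs_le_abs_sub (∫ ω, (F ω - mF) * (G ω - mG) * (H ω - mH) ∂μ)
    (∫ ω, (F ω - mF) * (max (-R) (min R (G ω - mG)) * max (-R) (min R (H ω - mH))) ∂μ)
  linarith

/-! ## §6. Toy instance (kernel) -/

/-- Toy: the clamp at level `1` sends `2` to `1`. -/
example : max (-(1 : ℝ)) (min 1 2) = 1 := by norm_num

end Summit.QuantumFields.BalabanUV.T4Continuum.NE7b.SupTruncationCumulantBound

end
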